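import Summits.FinalStateConjecture.FinalStateConjecture.Theorems.SwallowTheDatumKerrShieldedDataExistCapReparam
import Summits.FinalStateConjecture.FinalStateConjecture.Theorems.SwallowTheDatumBurialIntoShieldedBackground
import Literature.Geometry.Lorentzian.LiMeiCollapsePocket
import Literature.Geometry.Lorentzian.KerrCylinderVacuum
import Literature.Geometry.Lorentzian.InitialDataLocality
import Literature.Geometry.Lorentzian.InitialDataPullback
import HarnessLib

/-!
# Route SwallowTheDatum — crux `KerrShieldedDataExist` (stmt-FinalStateConjecture-10055), line `plug-the-second-sheet` v4:
# the exact Kerr-cylinder pocket from the two Li–Mei named facts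

Lead prover-line-stmt-FinalStateConjecture-10055-c1-0, 2026-08-16. The first stub of the reshaped skeleton,
`stub_exactPocket` — a smooth datum on `E3`, VACUUM on a ball `{‖y‖ < ρ₂}` and EXACTLY the standard
Kerr(`M, a`)-cylinder datum `{r = r₀}`, `r₋ < r₀ < r₊`, on a collar `{σ₂ < ‖y‖ < ρ₂}` — is the named-fact end of the
line: it is NOT provable inside the tree, but it FOLLOWS (this file, `exactPocket_of_liMei`) from the two published
theorems of J. Li, H. Mei, *A construction of collapsing spacetimes in vacuum*, CMP 378 (2020) = arXiv:2005.01249: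

* `LiMei.nearSchwarzschildPocket` (`Literature/Geometry/Lorentzian/LiMeiCollapsePocket.lean`): Thm 2.1 + §2.2 — for a
  fixed geometry and every `k, ε` a datum on `E3`, vacuum on `{‖y‖ < ρ₂}`, `ε`-close in `C^k` on `{ρ₁ < ‖y‖ < ρ₂}` to
  the Schwarzschild cylinder `{r = r₀ < 2m₀}` (short-pulse interior);
* `LiMei.interiorKerrGluing` (`Literature/Geometry/Lorentzian/InteriorKerrGluing.lean`): Prop 4.1 = Thm 2.2 — such a
  datum is deformed inside the annulus to one which is EXACTLY the Kerr(`m, a⃗`)-cylinder near the outer rim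
  (Corvino–Schoen with the `4`-parameter family `(m, a⃗)`), unchanged on an inner ball.

The plumbing: the deformed datum is vacuum on the whole ball (locality of the constraint functions,
`InitialDataSet.isVacuumAt_congr`, on the inner ball where it agrees with the pocket); and the rotation `R ∈ O(3)` of
the spin axis in the gluing's output (`kerrCylMap r₀ a τ₀ R`) is removed by pulling the datum back along `R⁻¹`
(`InitialDataSet.comap`, with the linear-map lemmas of `…BurialIntoShieldedBackground.lean`): `kerrCylMap r₀ a τ₀ R ∘ R⁻¹ = kerrCylMap r₀ a τ₀ id`, the vacuum constraints are natural
(`isVacuumAt_comap_iff`), and the induced data are natural under reparametrisation (`KerrCap.pullbackBilin_comp_of_repr`,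
`KerrCap.secondFundamentalForm_comp_of_repr`, `KerrCap.isFutureUnitNormal_comp` of `…CapReparam.lean`, with the
explicit future unit normal `LiMei.kerrCylUnitNormal` of `KerrInteriorCylinder.lean` / `KerrCylinderVacuum.lean`).
-/

set_option linter.dupNamespace false

-- instance search through the nested operator type `E →L[ℝ] E →L[ℝ] ℝ` (as in the tree files)
set_option maxSynthPendingDepth 3

noncomputable section

open Set Function Filter Topology TopologicalSpace
open scoped Manifold ContDiff Topology InnerProductSpace
open Literature.Geometry.Lorentzian

namespace Summit.FinalStateConjecture.FinalStateConjecture.Theorems.SwallowTheDatum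

namespace KerrCap

/-! ### Vacuum on the whole ball -/

/-- **The glued pocket is vacuum on the whole ball.** If `D` solves the vacuum constraints on `{‖y‖ < ρ₂}`, `D'`
agrees with `D` on the ball `{‖y‖ < σ₁}` (`ρ₁ < σ₁`) and solves the vacuum constraints on the annulus
`{ρ₁ < ‖y‖ < ρ₂}`, then `D'` solves them on `{‖y‖ < ρ₂}`: on the inner ball by LOCALITY of the constraint functions
(`InitialDataSet.isVacuumAt_congr`). Bartnik–Isenberg 2004, §2. [cite: BartnikIsenberg2004, §2] -/
theorem isVacuumOn_ball_of_agree {ρ₁ ρ₂ σ₁ : ℝ} {D D' : InitialDataSet (𝓡 3) E3} (hρσ : ρ₁ < σ₁)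
    (hD : LiMei.IsVacuumOn {y : E3 | ‖y‖ < ρ₂} D)
    (hagree : ∀ y : E3, ‖y‖ < σ₁ → D'.h.inner y = D.h.inner y ∧ D'.k y = D.k y)
    (hA : LiMei.IsVacuumOn {y : E3 | ρ₁ < ‖y‖ ∧ ‖y‖ < ρ₂} D') :
    LiMei.IsVacuumOn {y : E3 | ‖y‖ < ρ₂} D' := by
  intro inst' y hy
  by_cases hρ : ρ₁ < ‖y‖
  · exact hA y ⟨hρ, hy⟩
  · have hρ' : ‖y‖ ≤ ρ₁ := not_lt.mp hρ
    haveI instD : D.metric.HasLeviCivita := PseudoRiemannianMetric.hasLeviCivita _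
    have hyσ : ‖y‖ < σ₁ := hρ'.trans_lt hρσ
    have hball : ∀ᶠ z in 𝓝 y, ‖z‖ < σ₁ := (isOpen_lt continuous_norm continuous_const).mem_nhds hyσ
    have hh : ∀ᶠ z in 𝓝 y, D'.h.inner z = D.h.inner z := hball.mono fun z hz ↦ (hagree z hz).1
    have hk : ∀ᶠ z in 𝓝 y, D'.k z = D.k z := hball.mono fun z hz ↦ (hagree z hz).2
    exact (InitialDataSet.isVacuumAt_congr hh hk).2 (hD y hy)

/-! ### Removing the rotation of the spin axis: pull-back along a linear isometry -/

section Transport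

open BurialIntoShieldedBackground (contMDiff_linear injective_mfderiv_linear mfderiv_linear_apply)

/-- The sections of the datum pulled back along a linear automorphism `A` of `ℝ³`:
`(A^*D).h_y(v, w) = h_{A y}(A v, A w)`, `(A^*D).k_y(v, w) = k_{A y}(A v, A w)`. [cite: BartnikIsenberg2004, §2] -/
theorem comap_linear_apply (A : E3 ≃L[ℝ] E3) (D : InitialDataSet (𝓡 3) E3) (y v w : E3) :
    (D.comap (A : E3 → E3) (contMDiff_linear A) (injective_mfderiv_linear A)).h.inner y v w =
        D.h.inner (A y) (A v) (A w) ∧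
      (D.comap (A : E3 → E3) (contMDiff_linear A) (injective_mfderiv_linear A)).k y v w = D.k (A y) (A v) (A w) := by
  constructor
  · rw [InitialDataSet.comap_h_inner, mfderiv_linear_apply, mfderiv_linear_apply]
  · rw [InitialDataSet.comap_k, mfderiv_linear_apply, mfderiv_linear_apply]

/-- **The vacuum constraints on an `A`-invariant set transport along the pull-back by a linear automorphism `A`**
(naturality of the constraint map, `InitialDataSet.isVacuumAt_comap_iff`). [cite: BartnikIsenberg2004, §2] -/
theorem isVacuumOn_comap_linear (A : E3 ≃L[ℝ] E3) {s : Set E3} (hs : ∀ y, y ∈ s → A y ∈ s)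
    {D : InitialDataSet (𝓡 3) E3} (hD : LiMei.IsVacuumOn s D) :
    LiMei.IsVacuumOn s (D.comap (A : E3 → E3) (contMDiff_linear A) (injective_mfderiv_linear A)) := by
  intro inst' y hy
  haveI instD : D.metric.HasLeviCivita := PseudoRiemannianMetric.hasLeviCivita _
  exact (InitialDataSet.isVacuumAt_comap_iff D (contMDiff_linear A) (injective_mfderiv_linear A) y).2
    (hD (A y) (hs y hy))

/-- The standard Kerr cylinder map in position `R` is the standard-position map precomposed with `R`:
`kerrCylMap r₀ a τ₀ R y = kerrCylMap r₀ a τ₀ id (R y)` (`‖R y‖ = ‖y‖`). Li–Mei arXiv:2005.01249, §4, p. 22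
(`g_{m,a⃗} = (id × Ω_{a⃗})^* g_{m,a}`). [cite: LiMei2020, §4] -/
theorem kerrCylMap_apply_eq_id (r₀ a τ₀ : ℝ) (R : E3 →ₗᵢ[ℝ] E3) (y : E3) :
    LiMei.kerrCylMap r₀ a τ₀ R y = LiMei.kerrCylMap r₀ a τ₀ LinearIsometry.id (R y) := by
  simp only [LiMei.kerrCylMap, LinearIsometry.norm_map, LinearIsometry.coe_id, id_eq, LinearIsometry.map_smul]

variable [Kerr.Facts]

/-- **Exact Kerr-cylinder data in position `R` pull back, along `R⁻¹`, to exact Kerr-cylinder data in standard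
position** on any rotation-invariant set: the frame `ψ ∘ R⁻¹` has values `kerrCylMap r₀ a τ₀ id`, is a spacelike
immersion with future unit normal `ν ∘ R⁻¹` (`LiMei.isSpacelikeImmersion_kerrCyl`, `KerrCap.isFutureUnitNormal_comp`),
and the pulled-back sections are its induced data by naturality of the pull-back and of the second fundamental form
under reparametrisation (`KerrCap.pullbackBilin_comp_of_repr`, `KerrCap.secondFundamentalForm_comp_of_repr`, the normal
being the explicit `LiMei.kerrCylUnitNormal` by `LiMei.eq_kerrCylUnitNormal`). Li–Mei arXiv:2005.01249, Prop. 4.1;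
O'Neill 1983, Ch. 4, Lemma 4.4. [cite: LiMei2020, Prop. 4.1] [cite: ONeill1983, Ch. 4, Lemma 4.4] -/
theorem isKerrCylinderOn_comap_symm (Re : E3 ≃ₗᵢ[ℝ] E3) {m a r₀ τ₀ : ℝ} (ha : |a| < m)
    (h₁ : Kerr.rMinus m a < r₀) (h₂ : r₀ < Kerr.rPlus m a) {s : Set E3} (hs : ∀ y, y ∈ s → Re.symm y ∈ s)
    {D : InitialDataSet (𝓡 3) E3} (hD : LiMei.IsKerrCylinderOn m a r₀ τ₀ Re.toLinearIsometry s D) :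
    LiMei.IsKerrCylinderOn m a r₀ τ₀ LinearIsometry.id s
      (D.comap (Re.symm.toContinuousLinearEquiv : E3 → E3) (contMDiff_linear Re.symm.toContinuousLinearEquiv)
        (injective_mfderiv_linear Re.symm.toContinuousLinearEquiv)) := by
  obtain ⟨r₁, hm, ψ, ν, hr₁, hψ, hsp, hν, hh, hk⟩ := hD
  have hA : ∀ y : E3, (Re.symm.toContinuousLinearEquiv : E3 → E3) y = Re.symm y := fun _ ↦ rfl
  have hr₀ : 0 < r₀ := (Kerr.IsSubextremal.rMinus_nonneg ha).trans_lt h₁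
  -- the reparametrisation `θ = R⁻¹` of the slice `{1 < ‖y‖}`
  have hθmem : ∀ y : Kerr.slice 0 1, Re.symm (y : E3) ∈ Kerr.slice 0 1 := fun y ↦ by
    have h := y.2
    rw [Kerr.mem_slice, Kerr.radius_zero_left, E4.spatialNorm_ofTimeSpace] at h ⊢
    rwa [LinearIsometryEquiv.norm_map]
  set θ : Kerr.slice 0 1 → Kerr.slice 0 1 := fun y ↦ ⟨Re.symm (y : E3), hθmem y⟩ with hθdef
  have hθ : ∀ y : Kerr.slice 0 1, (θ y : E3) = (Re.symm : E3 → E3) y := fun y ↦ rfl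
  have hθd : ∀ y : Kerr.slice 0 1, DifferentiableAt ℝ (Re.symm : E3 → E3) y := fun y ↦
    (Re.symm.toContinuousLinearEquiv : E3 →L[ℝ] E3).differentiableAt
  have hfθ : ∀ (y : Kerr.slice 0 1) (v : E3), fderiv ℝ (Re.symm : E3 → E3) y v = Re.symm v := fun y v ↦ by
    have h : HasFDerivAt (Re.symm : E3 → E3)
        ((Re.symm.toContinuousLinearEquiv : E3 ≃L[ℝ] E3) : E3 →L[ℝ] E3) (y : E3) :=
      (Re.symm.toContinuousLinearEquiv : E3 ≃L[ℝ] E3).hasFDerivAt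
    rw [h.fderiv]
    rfl
  have hψd : ∀ y : Kerr.slice 0 1, MDifferentiableAt 𝓘(ℝ, E3) 𝓘(ℝ, E4) ψ y := fun y ↦
    hsp.contMDiff_self.mdifferentiableAt (by simp)
  -- the new frame
  set ψ' : Kerr.slice 0 1 → Kerr.region a r₁ := ψ ∘ θ with hψ'def
  have hψ' : ∀ y : Kerr.slice 0 1, (ψ' y : E4) = LiMei.kerrCylMap r₀ a τ₀ LinearIsometry.id (y : E3) := fun y ↦ by
    show ((ψ (θ y) : Kerr.region a r₁) : E4) = _
    rw [hψ, kerrCylMap_apply_eq_id]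
    show LiMei.kerrCylMap r₀ a τ₀ LinearIsometry.id (Re (Re.symm (y : E3))) = _
    rw [LinearIsometryEquiv.apply_symm_apply]
  refine ⟨r₁, hm, ψ', fun y ↦ ν (θ y), hr₁, hψ', LiMei.isSpacelikeImmersion_kerrCyl ha h₁ h₂ τ₀ _ hψ',
    KerrCap.isFutureUnitNormal_comp hθ hθd hψd hν, fun y hy ↦ ?_, ?_⟩
  · -- the pulled-back metric is the induced metric of the reparametrised frame
    have hmem : ((θ y : Kerr.slice 0 1) : E3) ∈ s := hs _ hy
    have h := hh (θ y) hmem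
    have key : ∀ v w : E3,
        (D.comap (Re.symm.toContinuousLinearEquiv : E3 → E3) (contMDiff_linear Re.symm.toContinuousLinearEquiv)
          (injective_mfderiv_linear Re.symm.toContinuousLinearEquiv)).h.inner (y : E3) v w =
        pullbackBilin (I := 𝓘(ℝ, E4)) (I' := 𝓘(ℝ, E3)) ψ' (Kerr.smoothMetric m a r₁).val y v w := by
      intro v w
      have e1 := (comap_linear_apply Re.symm.toContinuousLinearEquiv D (y : E3) v w).1
      have e2 := KerrCap.pullbackBilin_comp_of_repr hθ (hθd y) (hψd (θ y)) (Kerr.smoothMetric m a r₁).val v w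
      rw [hfθ, hfθ] at e2
      have e3 : pullbackBilin (I := 𝓘(ℝ, E4)) (I' := 𝓘(ℝ, E3)) ψ (Kerr.smoothMetric m a r₁).val (θ y)
          (Re.symm v) (Re.symm w) = D.h.inner ((θ y : Kerr.slice 0 1) : E3) (Re.symm v) (Re.symm w) := by
        rw [h]
        exact rfl
      exact e1.trans (e3.symm.trans e2.symm)
    exact ContinuousLinearMap.ext fun v ↦ ContinuousLinearMap.ext fun w ↦ key v w
  · -- the pulled-back `k` is the second fundamental form of the reparametrised frame
    intro inst y hy
    refine LinearMap.ext fun v ↦ LinearMap.ext fun w ↦ ?_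
    have hmem : ((θ y : Kerr.slice 0 1) : E3) ∈ s := hs _ hy
    have hy0 : ((θ y : Kerr.slice 0 1) : E3) ≠ 0 := LiMei.ne_zero_of_mem_slice _
    -- explicit representatives at the point `θ y`
    have hνN : ∀ z : Kerr.slice 0 1, ν z = (fun u : E3 ↦ LiMei.kerrCylUnitNormal m a
        (LiMei.kerrCylMap r₀ a τ₀ Re.toLinearIsometry u)) (z : E3) := fun z ↦ by
      rw [LiMei.eq_kerrCylUnitNormal hm ha h₁ h₂ τ₀ Re.toLinearIsometry hψ hν z, hψ z]
    have hΦd : DifferentiableAt ℝ (LiMei.kerrCylMap r₀ a τ₀ Re.toLinearIsometry) ((θ y : Kerr.slice 0 1) : E3) :=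
      LiMei.differentiableAt_kerrCylMap r₀ a τ₀ _ hy0
    have hradq := LiMei.radius_pos_and_bilin_radiusSharp_neg (U := Kerr.slice 0 1) ha h₁ h₂
      (fun z ↦ LiMei.ne_zero_of_mem_slice z) hψ (θ y)
    rw [hψ (θ y)] at hradq
    have hNd : DifferentiableAt ℝ (fun u : E3 ↦ LiMei.kerrCylUnitNormal m a
        (LiMei.kerrCylMap r₀ a τ₀ Re.toLinearIsometry u)) ((θ y : Kerr.slice 0 1) : E3) :=
      ((LiMei.contDiffAt_kerrCylUnitNormal hradq.1 hradq.2 (n := 1)).differentiableAt one_ne_zero).comp _ hΦd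
    have hK := KerrCap.secondFundamentalForm_comp_of_repr hθ (Kerr.smoothMetric_val_eq_bilin m a r₁) hψ hνN
      (hθd y) hΦd hNd (Kerr.differentiableAt_bilin m a (ψ (θ y))) v w
    rw [hfθ, hfθ] at hK
    have hkθ := hk (θ y) hmem
    have hkθvw : D.k ((θ y : Kerr.slice 0 1) : E3) (Re.symm v) (Re.symm w) =
        (Kerr.smoothMetric m a r₁).secondFundamentalForm 𝓘(ℝ, E3) ψ ν (θ y) (Re.symm v) (Re.symm w) :=
      LinearMap.congr_fun (LinearMap.congr_fun hkθ (Re.symm v)) (Re.symm w)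
    show (D.comap (Re.symm.toContinuousLinearEquiv : E3 → E3) (contMDiff_linear Re.symm.toContinuousLinearEquiv)
        (injective_mfderiv_linear Re.symm.toContinuousLinearEquiv)).k (y : E3) v w = _
    rw [(comap_linear_apply Re.symm.toContinuousLinearEquiv D _ v w).2]
    show D.k ((θ y : Kerr.slice 0 1) : E3) (Re.symm v) (Re.symm w) = _
    rw [hkθvw, ← hK]
    rfl

end Transport

end KerrCap

/-! ### The exact pocket from the two named facts -/

/-- **The exact Kerr-cylinder pocket from Li–Mei's two theorems** (the conditional form of the skeleton's
`stub_exactPocket`, whose statement is the conclusion verbatim): the near-Schwarzschild pocket (Thm 2.1 + §2.2,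
`LiMei.nearSchwarzschildPocket`) at the order `k` and threshold `ε₀` demanded by the interior Kerr gluing (Prop 4.1,
`LiMei.interiorKerrGluing`, chart inner radius `r₁ := r₀/2`) is deformed to a datum which is unchanged on an inner
ball, vacuum on the annulus and exactly the Kerr(`m, a⃗`)-cylinder `{r = r₀}` near the outer rim,
`|m − M| + |a| ≤ Cε₀`, `|a| < m`, `r₋(m,a) < r₀ < r₊(m,a)`; it is vacuum on the whole ball
(`KerrCap.isVacuumOn_ball_of_agree`), and pulling back along the inverse of the axis rotation puts the cylinder in
standard position (`KerrCap.isKerrCylinderOn_comap_symm`, `KerrCap.isVacuumOn_comap_linearIsometryEquiv`).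
[cite: LiMei2020, Thm 2.1, §2.2, Prop. 4.1] -/
theorem exactPocket_of_liMei : Literature.Geometry.Lorentzian.LiMei.nearSchwarzschildPocket →
    Literature.Geometry.Lorentzian.LiMei.interiorKerrGluing →
    (∀ [Kerr.Facts], ∃ (M a r₀ τ₀ σ₂ ρ₂ : ℝ) (D' : InitialDataSet (𝓡 3) E3),
      |a| < M ∧ Kerr.rMinus M a < r₀ ∧ r₀ < Kerr.rPlus M a ∧ 1 ≤ σ₂ ∧ σ₂ < ρ₂ ∧
      LiMei.IsVacuumOn {y : E3 | ‖y‖ < ρ₂} D' ∧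
      LiMei.IsKerrCylinderOn M a r₀ τ₀ LinearIsometry.id {y : E3 | σ₂ < ‖y‖ ∧ ‖y‖ < ρ₂} D') := by
  intro hP hG inst
  obtain ⟨M, r₀, ρ₁, ρ₂, hr₀, hr₀M, hρ₁, hρ₁₂, hpocket⟩ := @hP inst
  have hr₁ : 0 < r₀ / 2 := by positivity
  have hr₁₀ : r₀ / 2 < r₀ := by linarith
  obtain ⟨k, C, ε₀, hε₀, hglue⟩ := @hG inst M (r₀ / 2) r₀ ρ₁ ρ₂ hr₁ hr₁₀ hr₀M hρ₁ hρ₁₂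
  obtain ⟨D, hDvac, hDnear⟩ := hpocket (r₀ / 2) hr₁ hr₁₀ k ε₀ hε₀
  obtain ⟨D', m, a, τ₀, σ₁, σ₂, R, -, ha, hm₁, hm₂, hρσ₁, hσ₁₂, hσ₂ρ, hagree, hvacA, hcyl⟩ :=
    hglue ε₀ hε₀ le_rfl D (fun {_} y hy ↦ hDvac y hy.2) hDnear
  -- vacuum on the whole ball
  have hvac' : LiMei.IsVacuumOn {y : E3 | ‖y‖ < ρ₂} D' :=
    KerrCap.isVacuumOn_ball_of_agree hρσ₁ hDvac hagree hvacA
  -- remove the rotation of the spin axis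
  set Re : E3 ≃ₗᵢ[ℝ] E3 := R.toLinearIsometryEquiv rfl with hRe
  have hReR : Re.toLinearIsometry = R := by
    ext y
    rfl
  rw [← hReR] at hcyl
  refine ⟨m, a, r₀, τ₀, σ₂, ρ₂, D'.comap (Re.symm.toContinuousLinearEquiv : E3 → E3)
    (BurialIntoShieldedBackground.contMDiff_linear Re.symm.toContinuousLinearEquiv)
    (BurialIntoShieldedBackground.injective_mfderiv_linear Re.symm.toContinuousLinearEquiv), ha, hm₁, hm₂,
    by linarith, hσ₂ρ, KerrCap.isVacuumOn_comap_linear Re.symm.toContinuousLinearEquiv (fun y hy ↦ ?_) hvac',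
    KerrCap.isKerrCylinderOn_comap_symm Re ha hm₁ hm₂ (fun y hy ↦ ?_) hcyl⟩
  · show Re.symm y ∈ {y : E3 | ‖y‖ < ρ₂}
    simpa only [mem_setOf_eq, LinearIsometryEquiv.norm_map] using hy
  · simpa only [mem_setOf_eq, LinearIsometryEquiv.norm_map] using hy

end Summit.FinalStateConjecture.FinalStateConjecture.Theorems.SwallowTheDatum

end
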